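import Summits.AtomisticToContinuum.HydrodynamicLimit.Theses.TwoClocks
import Summits.AtomisticToContinuum.HydrodynamicLimit.Theorems.TwoClocksClampedWindowDockGronwall
import Summits.AtomisticToContinuum.HydrodynamicLimit.Theorems.OneFlightGossipEngineClampedCurrentsDockReduction
import Summits.AtomisticToContinuum.HydrodynamicLimit.Theorems.TwoClocksClampedEntropyClockDiscreteEntropyGronwall
import Summits.AtomisticToContinuum.HydrodynamicLimit.Theorems.TwoClocksClampedEntropyClockTimeZeroReference

/-!
# Crux stmt-AtomisticToContinuum-15145 `TwoClocks.ClampedEntropyClock`, line `IdeatorTwoSketch` — the RESTATED clock (planner-facing, typed; lead c2)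

Status of the item AS FILED: antecedent #2 `EquilibriumClampedCollisionalWindowLD` (stmt-13733) is refuted in Lean by its disprover
(Newton-cradle energy relay against the ENERGY row; landing as `Theorems/TwoClocksEquilibriumClampedCollisionalWindowLDRefutation.lean`),
so the crux closes ex falso (`fun _ h₃ _ _ _ => absurd h₃ …`) — ledger progress only. This work file TYPES the substantive clock the
planner is asked to file instead (leads c1/c2, `Lines/IdeatorTwoSketch.md` §4/§4′; disprover `Disproof.lean` §7), and kernel-checks
what its open residue is:

* `KineticWindowLDUniformBounded` — repair R1 of the energy-row bookkeeping: the docking node for BOUNDED fast functionals in the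
  `∀ β` shape (`τ` after `β`), consumed by the truncated heat flux `F_M` (the typed node `KineticWindowLDUniform` keeps feeding the
  quadratic stress channel at its `∃ β₀`);
* `LocalClampedTransferWindowLDUniform` — restatement (A): the collisional input DOCKED UNDER LOCAL GIBBS DATA exactly like the kinetic
  one (transfer-activity clamp C′, x-frozen EOS coefficients, centring c-numbers, `η₀`-uniform); byte-identical with
  `Cruxes/ClampedCurrentsDock/Lines/IdeatorTwoSketch.lean :: LocalClampedTransferWindowLD` (OFGE dock 14680), so one item serves both routes.
  With a local collisional node the clock needs NO in-clock localisation and NO influence-locality input (S6 of this line, false as typed);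
* `TransferActivityTails` — the a-priori `L¹` tails of the window TRANSFER activity (momentum + energy impulse) under the true law: prices
  the clamp of C′ (pathwise remainder `≤ ‖∇φ‖ Σ_i a_i 1{a_i > V}` with the transfer activity); implied by `CollisionActivityTails ∧`
  its energy twin (`(a+b)1{a+b>2V} ≤ 2a1{a>V} + 2b1{b>V}`);
* `ClampedEntropyClockRestated := KineticWindowLDUniform → KineticWindowLDUniformBounded → LocalClampedTransferWindowLDUniform →
  TransferActivityTails → EnergyCurrentTails → DiluteSelfConsistency → HydrodynamicLimit`;
* `WindowEntropyStepRestated` — the ONE-WINDOW ENTROPY STEP fed by the restated inputs (the registered heart `stub_windowEntropyStep`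
  with `hIL` deleted, `h₃ := local C′`, `h₇ := transfer tails`, `+ hKb`): the single XL obligation left, to be PROMOTED as one item
  shared with 14680's `LedgerIntegratedInequality` (same mathematics; their interface is the integrated/running-sup form);
* `KlDivLawAtLocalGibbsFinite` — finiteness of the entropies along the reference family: LANDED as
  `QuenchedCellClock.stub_klDivLawAtLocalGibbsNeTop` (p107857; kept as a hypothesis here only because the farm snapshot has not built it);
* `clampedEntropyClockRestated_of` — KERNEL-CHECKED COMPOSITION: `WindowEntropyStepRestated → KlDivLawAtLocalGibbsFinite →
  ClampedEntropyClockRestated`, by the line's LANDED glue: abstract window Gronwall `stub_discreteEntropyGronwall` (p100251), time-zero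
  identification `stub_timeZeroReference` (p101191), `klDiv_lawAt_zero_localGibbsLaw` (13735 part I) and the antecedent-agnostic reduction
  `ClampedCurrentsDockReduction.stub_reduction : RelEntropyCoreRf → DiluteSelfConsistency → HydrodynamicLimit` (14680 S1, p97835; the two
  routes' `DiluteSelfConsistency` agree definitionally).

No `sorry`. Nothing here is asserted about the filed crux; the new Props are CANDIDATE STATEMENTS for the planner (conjecture-grade
inputs: the two nodes and the tails; XL prover obligation: the window step).
-/

noncomputable section

namespace Summit.AtomisticToContinuum.HydrodynamicLimit.Theorems.QuenchedCellClock

open MeasureTheory Set Filter Topology InformationTheory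
open scoped ENNReal Classical
open Literature.MathematicalPhysics.KineticTheory Literature.Analysis.FluidPDE Literature.Analysis.FunctionSpaces
open Summit.AtomisticToContinuum.HydrodynamicLimit.Theses.TwoClocks
open Summit.AtomisticToContinuum.HydrodynamicLimit.Theorems.EntropyClockDock

/-! ## §1 The restated inputs -/

/-- **R1 — the docking node for BOUNDED fast functionals, `∀ β` shape.** Frame of `KineticWindowLDUniform` (local Gibbs data,
`η₀`-uniform over dilute profiles, `F` continuous and orthogonal at every `x` under `M_(1,u₀(x),θ₀(x))` to `1, v_j, |v|²`) with the
quadratic-growth hypothesis replaced by BOUNDEDNESS and the conclusion in the shape `∀ β ∀ ε ∃ τ ∃ N₀`: every tilt is admissible for a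
bounded functional (its exponential moments are finite at every `N`), the window `τ = τ(β, ε)` being chosen after `β`. Consumed by the
truncated heat flux `F_M` of the energy row (`Disproof.lean` §7: with `∃ β₀(F_M)` after `∀ F` the Gronwall certificate is not driven to
`0`; with this shape it is, `ClampedEntropyClockNegative.allBeta_gronwallBound_small`). [folklore] -/
def KineticWindowLDUniformBounded : Prop :=
  ∃ η₀ : ℝ, 0 < η₀ ∧ ∀ (a θ₀ : T3 → ℝ) (u₀ : T3 → V3), Continuous a → Continuous θ₀ → Continuous u₀ → (∀ x, 0 < a x) →
    (∀ x, 0 < θ₀ x) → ∀ σ : ℝ, 0 < σ → σ ^ 3 * (⨆ x, a x) ≤ η₀ * ∫ x, a x →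
    ∀ Φ : (N : ℕ) → HardSphereFlow (Torus.geometry (Fin 3)) (hsDiameter σ N) (N + 1),
    ∀ F : T3 × V3 → ℝ, Continuous F → (∃ C : ℝ, ∀ y, |F y| ≤ C) →
    (∀ x, ∫ v, F (x, v) * localMaxwellian 1 (θ₀ x) (u₀ x) v = 0) →
    (∀ x (j : Fin 3), ∫ v, F (x, v) * v j * localMaxwellian 1 (θ₀ x) (u₀ x) v = 0) →
    (∀ x, ∫ v, F (x, v) * ‖v‖ ^ 2 * localMaxwellian 1 (θ₀ x) (u₀ x) v = 0) →
    ∀ β : ℝ, ∀ ε : ℝ, 0 < ε → ∃ τ : ℝ, 0 < τ ∧ ∃ N₀ : ℕ, ∀ N : ℕ, N₀ ≤ N →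
      ∫⁻ z, ENNReal.ofReal (Real.exp (β * ∑ i : Fin (N + 1), (τ * ((N : ℝ) + 1) ^ (-(1 / 3 : ℝ)))⁻¹ *
          ∫ r in (0 : ℝ)..(τ * ((N : ℝ) + 1) ^ (-(1 / 3 : ℝ))), F (((Φ N).flow r z) i)))
        ∂(localGibbsLaw σ a u₀ θ₀ N (Φ N)) ≤ ENNReal.ofReal (Real.exp (ε * ((N : ℝ) + 1)))

/-- **(A) — the LOCAL clamped collisional-TRANSFER window LD, `η₀`-uniform** (the collisional docking node; byte-identical with
`Cruxes/ClampedCurrentsDock/Lines/IdeatorTwoSketch.lean :: LocalClampedTransferWindowLD`, OFGE dock stmt-14680, so that ONE filed item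
serves both docks). Frame of `KineticWindowLDUniform`; functionals of the repaired crux 3 (C′ = `ClampedTransferWindowLD`: TRANSFER
activity `a_i = (σ/τ) Σ_{coll of i in (0,w]} (|Δv_i| + |Δ|v_i|²|/2)`, clamp `ω_i = 1{a_i ≤ V}`) with the EOS coefficients FROZEN AT THE
PARTICLE'S POSITION (`η(x) = ρ₀(x)σ³`, `ρ₀ = rhoLim (profileOf a) σ`, peculiar velocity `v − u₀(x)`) and CENTRED by the c-numbers that make
the ψ-means of `X` and `A` agree (they vanish on constant profiles, `∫∂_kφ = 0`). Quantifiers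
`∃η₀ ∀data ∀Φ ∀φ ∃V₀ ∀V ∃β₀ ∀β ∀ε ∃τ₀ ∀τ ∃N₀ ∀N`. [folklore] -/
def LocalClampedTransferWindowLDUniform : Prop :=
  ∃ η₀ : ℝ, 0 < η₀ ∧ ∀ (a θ₀ : T3 → ℝ) (u₀ : T3 → V3) (ha : Continuous a), Continuous θ₀ → Continuous u₀ →
    ∀ (ha0 : ∀ x, 0 < a x), (∀ x, 0 < θ₀ x) → ∀ σ : ℝ, 0 < σ → σ < 1 / 2 → σ ^ 3 * (⨆ x, a x) ≤ η₀ * ∫ x, a x →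
    ∀ Φ : (N : ℕ) → HardSphereFlow (Torus.geometry (Fin 3)) (hsDiameter σ N) (N + 1),
    ∀ φ : T3 → ℝ, Torus.IsSmooth φ →
    ∃ V₀ : ℝ, 0 < V₀ ∧ ∀ V : ℝ, V₀ ≤ V → ∃ β₀ : ℝ, 0 < β₀ ∧ ∀ β : ℝ, |β| ≤ β₀ → ∀ ε : ℝ, 0 < ε →
    ∃ τ₀ : ℝ, 0 < τ₀ ∧ ∀ τ : ℝ, τ₀ ≤ τ → ∃ N₀ : ℕ, ∀ N : ℕ, N₀ ≤ N →
      (let ρ₀ : T3 → ℝ := rhoLim (profileOf a ha ha0) σ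
       let w : ℝ := τ * ((N : ℝ) + 1) ^ (-(1 / 3 : ℝ))
       let P := localGibbsLaw σ a u₀ θ₀ N (Φ N)
       let Z : T3 → ℝ := fun x => hsCompressibility (ρ₀ x * σ ^ 3)
       let Z' : T3 → ℝ := fun x => deriv hsCompressibility (ρ₀ x * σ ^ 3)
       let act := fun (i : Fin (N + 1)) (z : Config (N + 1) (Fin 3) T3) =>
         σ / τ * (Φ N).collisionSum (Set.Ioc 0 w) (fun c => if c.fst = i then
           ‖c.postVel.1 - c.preVel.1‖ + |‖c.postVel.1‖ ^ 2 - ‖c.preVel.1‖ ^ 2| / 2 else 0) z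
       let ω := fun (i : Fin (N + 1)) (z : Config (N + 1) (Fin 3) T3) => if act i z ≤ V then (1 : ℝ) else 0
       let Xm := fun (k : Fin 3) (z : Config (N + 1) (Fin 3) T3) =>
         (Φ N).collisionSum (Set.Ioc 0 w)
           (fun c => ω c.fst z * ω c.snd z * ((φ c.fstPos - φ c.sndPos) * (c.postVel.1 k - c.preVel.1 k)) / 2) z
       let Am := fun (k : Fin 3) (z : Config (N + 1) (Fin 3) T3) =>
         (∫ r in (0 : ℝ)..w, ∑ i : Fin (N + 1), Torus.partialDeriv k φ ((Φ N).flow r z i).1 *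
           (θ₀ ((Φ N).flow r z i).1 * (ρ₀ ((Φ N).flow r z i).1 * σ ^ 3) * Z' ((Φ N).flow r z i).1 +
             (1 / 3) * (Z ((Φ N).flow r z i).1 - 1) * ‖((Φ N).flow r z i).2 - u₀ ((Φ N).flow r z i).1‖ ^ 2)) -
         w * ((N : ℝ) + 1) * ∫ x, ρ₀ x * Torus.partialDeriv k φ x * (θ₀ x * (ρ₀ x * σ ^ 3) * Z' x)
       let Xe := fun (z : Config (N + 1) (Fin 3) T3) =>
         (Φ N).collisionSum (Set.Ioc 0 w)
           (fun c => ω c.fst z * ω c.snd z *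
             ((φ c.fstPos - φ c.sndPos) * ((‖c.postVel.1‖ ^ 2 - ‖c.preVel.1‖ ^ 2) / 2)) / 2) z
       let Ae := fun (z : Config (N + 1) (Fin 3) T3) =>
         (∫ r in (0 : ℝ)..w, ∑ i : Fin (N + 1),
           ((∑ l : Fin 3, u₀ ((Φ N).flow r z i).1 l * Torus.partialDeriv l φ ((Φ N).flow r z i).1) *
               (θ₀ ((Φ N).flow r z i).1 * (ρ₀ ((Φ N).flow r z i).1 * σ ^ 3) * Z' ((Φ N).flow r z i).1 +
                 (1 / 3) * (Z ((Φ N).flow r z i).1 - 1) * ‖((Φ N).flow r z i).2 - u₀ ((Φ N).flow r z i).1‖ ^ 2) +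
             θ₀ ((Φ N).flow r z i).1 * (Z ((Φ N).flow r z i).1 - 1) *
               (∑ l : Fin 3, Torus.partialDeriv l φ ((Φ N).flow r z i).1 *
                 (((Φ N).flow r z i).2 - u₀ ((Φ N).flow r z i).1) l))) -
         w * ((N : ℝ) + 1) *
           ∫ x, ρ₀ x * (∑ l : Fin 3, u₀ x l * Torus.partialDeriv l φ x) * (θ₀ x * (ρ₀ x * σ ^ 3) * Z' x)
       (∀ k : Fin 3, ∫⁻ z, ENNReal.ofReal (Real.exp (β * (w⁻¹ * Xm k z - w⁻¹ * Am k z))) ∂P ≤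
           ENNReal.ofReal (Real.exp (ε * ((N : ℝ) + 1)))) ∧
         ∫⁻ z, ENNReal.ofReal (Real.exp (β * (w⁻¹ * Xe z - w⁻¹ * Ae z))) ∂P ≤
           ENNReal.ofReal (Real.exp (ε * ((N : ℝ) + 1))))

/-- **A-priori `L¹` tails of the window TRANSFER activity under the true evolution** (`CollisionActivityTails`, stmt-13734, with the
momentum impulse `‖v⁺ − v⁻‖` replaced by the transfer impulse `‖v⁺ − v⁻‖ + |‖v⁺‖² − ‖v⁻‖²|/2`): prices the transfer clamp of C′ —
every dropped collision has a clamped partner and contact gives `|φ(x_i) − φ(x_j)| ≤ ‖∇φ‖ε_N`, so for the momentum AND the energy row the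
pathwise remainder is `≤ ‖∇φ‖_∞ Σ_i a_i 1{a_i > V}` with THIS activity. Implied by 13734 together with its energy twin. [folklore] -/
def TransferActivityTails : Prop :=
  ∀ (a₀ θ₀ : T3 → ℝ) (u₀ : T3 → V3), Continuous a₀ → Continuous θ₀ → Continuous u₀ → (∀ x, 0 < a₀ x) →
    (∀ x, 0 < θ₀ x) → ∃ σ₀ : ℝ, 0 < σ₀ ∧ ∀ σ : ℝ, 0 < σ → σ < σ₀ →
    ∀ (T : ℝ) (ρ θ : ℝ → T3 → ℝ) (u : ℝ → T3 → V3), IsHardSphereEulerSolution σ T ρ u θ →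
    ∀ Φ : (N : ℕ) → HardSphereFlow (Torus.geometry (Fin 3)) (hsDiameter σ N) (N + 1),
    TendstoHydroFieldsAt (fun N => localGibbsLaw σ a₀ u₀ θ₀ N (Φ N)) Φ ρ u θ 0 →
    ∀ t ∈ Set.Ico 0 T, ∃ V₀ : ℝ, 0 < V₀ ∧ ∀ V : ℝ, V₀ ≤ V → ∀ ε : ℝ, 0 < ε → ∃ τ₀ : ℝ, 0 < τ₀ ∧
    ∀ τ : ℝ, τ₀ ≤ τ → ∃ N₀ : ℕ, ∀ N : ℕ, N₀ ≤ N → ∀ s ∈ Set.Icc 0 t,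
      (let w : ℝ := τ * ((N : ℝ) + 1) ^ (-(1 / 3 : ℝ))
       let P := localGibbsLaw σ a₀ u₀ θ₀ N (Φ N)
       let act := fun (i : Fin (N + 1)) (z : Config (N + 1) (Fin 3) T3) =>
         σ / τ * (Φ N).collisionSum (Set.Ioc s (s + w))
           (fun c => if c.fst = i then ‖c.postVel.1 - c.preVel.1‖ + |‖c.postVel.1‖ ^ 2 - ‖c.preVel.1‖ ^ 2| / 2 else 0) z
       ∫⁻ z, ENNReal.ofReal (((N : ℝ) + 1)⁻¹ * ∑ i : Fin (N + 1),
           Set.indicator {y : ℝ | V < y} (fun y => y) (act i z)) ∂P ≤ ENNReal.ofReal ε)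

/-- **The RESTATED macroscopic clock** (candidate replacement of `ClampedEntropyClock` once crux 3 is re-filed as C′ docked locally):
Yau's relative-entropy Gronwall fed by the kinetic docking node (typed + its bounded `∀β` companion R1), the LOCAL clamped transfer node,
the transfer-activity tails, the cubic energy-current tails and dilute self-consistency. [folklore] -/
def ClampedEntropyClockRestated : Prop :=
  KineticWindowLDUniform → KineticWindowLDUniformBounded → LocalClampedTransferWindowLDUniform → TransferActivityTails →
    EnergyCurrentTails → DiluteSelfConsistency → _root_.HydrodynamicLimit

/-- **Sanity: the restated clock is still weaker than the Statement** (so no refutation short of `¬ HydrodynamicLimit`). [folklore] -/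
theorem clampedEntropyClockRestated_of_hydrodynamicLimit (h : _root_.HydrodynamicLimit) : ClampedEntropyClockRestated :=
  fun _ _ _ _ _ _ => h

/-! ## §2 The residue: the one-window entropy step with the restated inputs (XL; to be promoted as ONE item) -/

/-- **Finiteness of the relative entropies along the reference family** — LANDED as `QuenchedCellClock.stub_klDivLawAtLocalGibbsNeTop`
(p107857, `Theorems/TwoClocksClampedEntropyClockKlDivLawAtLocalGibbsNeTop.lean`); a hypothesis of the composition below only because
the farm snapshot has not yet built that module (replace by the import). [cite: Yau1991, §2] -/
def KlDivLawAtLocalGibbsFinite : Prop :=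
  ∀ {σ : ℝ}, 0 < σ → σ ≤ 1 / 2 → ∀ {a₀ θ₀ b ϑ : T3 → ℝ} {u₀ w : T3 → V3},
    Continuous a₀ → Continuous θ₀ → Continuous u₀ → (∀ x, 0 < a₀ x) → (∀ x, 0 < θ₀ x) →
    Continuous b → Continuous ϑ → Continuous w → (∀ x, 0 < b x) → (∀ x, 0 < ϑ x) →
    ∀ (N : ℕ) (Φ : HardSphereFlow (Torus.geometry (Fin 3)) (hsDiameter σ N) (N + 1)) (s : ℝ),
      klDiv (Φ.lawAt (localGibbsLaw σ a₀ u₀ θ₀ N Φ) s) (localGibbsLaw σ b w ϑ N Φ) ≠ ⊤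

/-- **THE HEART, RESTATED — one-window entropy increments along the explicit reference family, fed by the restated inputs.** The
registered heart `stub_windowEntropyStep` of the line with the influence-locality hypothesis `hIL` DELETED (no in-clock localisation),
`h₃ := LocalClampedTransferWindowLDUniform` (collisional side docked locally), `h₇ := TransferActivityTails` and the bounded-functional
node `hKb` ADDED (energy row, R1); frame (`Rf`, `η₀` + matrix of `UniformLocalGibbsConcentration`, `HsEosLowDensity`,
`DiluteSelfConsistency`, profiles, tied Euler solution, flow family, `t ∈ (0,T)`) and conclusion (rate `A` fixed before `ε`, windows
`w_N`, full-window step + last partial window) UNCHANGED. Intended proof = pure Yau bookkeeping on landed pieces: entropy identity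
(`toReal_klDiv_lawAt_localGibbsLaw_sub`, `ae_logRatio_eq_oneBody`), pathwise production (`CollisionalTransferTimeDep`,
`ClampedCurrentsDockPathwise.stub_pathwise`), Euler in entropy variables (`stub_entropyVariablesProduction`, p108602 /
`stub_cancellation`), EOS statics, entropy inequality at one `β` (`stub_entropyInequalityTensorised`, p96792) fed DIRECTLY by the two local
nodes, clamp remainder × transfer tails (`abs_collisionSum_unclamped_le`), heat-flux truncation with `β` after `M` (R1 + ECT), `s`-net
uniformity (`stub_lintegralExpLeOfHellinger` / `stub_hellingerLocalGibbsLe` / `stub_windowPerturbationLe`, p96950 p97708 p97064).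
Same mathematics as 14680's `LedgerIntegratedInequality` (integrated/running-sup interface there). [cite: Yau1991, §2]
[cite: OllaVaradhanYau1993, §3] [cite: KipnisLandim1999, Ch. 6 §1] -/
def WindowEntropyStepRestated : Prop :=
  ∀ {r : ℝ} {Rf : ℝ → ℝ} (hr : 0 < r)
    (hsol : ∀ x ∈ Set.Ioo (-r) r, 0 < Rf x ∧ Rf x * (∑' j : ℕ, bE j / (j.factorial : ℝ) * (x * Rf x) ^ j) = 1)
    (hbd : ∀ x ∈ Set.Icc 0 r, 1 ≤ Rf x ∧ Rf x ≤ 2) (hcont : ContinuousOn Rf (Set.Icc 0 r))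
    (huniq : ∀ x ∈ Set.Ioo (-r) r, ∀ R ∈ Set.Icc (1 / 2 : ℝ) 2,
      R * (∑' j : ℕ, bE j / (j.factorial : ℝ) * (x * R) ^ j) = 1 → R = Rf x)
    {η₀ : ℝ} (hη₀ : 0 < η₀)
    (HU : ∀ (a θ₀ : T3 → ℝ) (u₀ : T3 → V3), Continuous a → Continuous θ₀ → Continuous u₀ → (∀ x, 0 < a x) →
      (∀ x, 0 < θ₀ x) → ∀ σ : ℝ, 0 < σ → σ ^ 3 * (⨆ x, a x) ≤ η₀ * ∫ x, a x →
      ∃ ρ₀ : T3 → ℝ, Continuous ρ₀ ∧ (∀ x, 0 < ρ₀ x) ∧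
        (∀ (N : ℕ) (Φ : HardSphereFlow (Torus.geometry (Fin 3)) (hsDiameter σ N) (N + 1)),
          IsProbabilityMeasure (localGibbsLaw σ a u₀ θ₀ N Φ)) ∧
        ∀ χ : T3 → ℝ, Continuous χ → ∀ δ : ℝ, 0 < δ → ∃ C : ℝ, 0 < C ∧
          ∀ (N : ℕ) (Φ : HardSphereFlow (Torus.geometry (Fin 3)) (hsDiameter σ N) (N + 1)),
            localGibbsLaw σ a u₀ θ₀ N Φ {z | δ < |empiricalDensityField z χ - ∫ x, χ x * ρ₀ x|} ≤
                ENNReal.ofReal (C * Real.exp (-(C⁻¹ * ((N : ℝ) + 1)))) ∧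
              localGibbsLaw σ a u₀ θ₀ N Φ
                  {z | δ < ‖empiricalMomentumField z χ - ∫ x, (χ x * ρ₀ x) • u₀ x‖} ≤
                ENNReal.ofReal (C * Real.exp (-(C⁻¹ * ((N : ℝ) + 1)))) ∧
              localGibbsLaw σ a u₀ θ₀ N Φ {z | δ < |empiricalEnergyField z χ -
                  ∫ x, χ x * totalEnergyDensity (ρ₀ x) (u₀ x) (θ₀ x)|} ≤
                ENNReal.ofReal (C * Real.exp (-(C⁻¹ * ((N : ℝ) + 1)))))
    (hK : KineticWindowLDUniform) (hKb : KineticWindowLDUniformBounded) (hC : LocalClampedTransferWindowLDUniform)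
    (hT : TransferActivityTails) (h₆ : EnergyCurrentTails) (hEos : HsEosLowDensity) (hS : DiluteSelfConsistency)
    (a₀ θ₀ : T3 → ℝ) (u₀ : T3 → V3) (ha : Continuous a₀) (hθ : Continuous θ₀) (hu : Continuous u₀)
    (ha0 : ∀ x, 0 < a₀ x) (hθ0 : ∀ x, 0 < θ₀ x),
    ∃ σ₀ : ℝ, 0 < σ₀ ∧ ∀ σ : ℝ, 0 < σ → σ < σ₀ →
      ∀ (T : ℝ) (ρ θ : ℝ → T3 → ℝ) (u : ℝ → T3 → V3), IsHardSphereEulerSolution σ T ρ u θ →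
        ∀ Φ : (N : ℕ) → HardSphereFlow (Torus.geometry (Fin 3)) (hsDiameter σ N) (N + 1),
          TendstoHydroFieldsAt (fun N => localGibbsLaw σ a₀ u₀ θ₀ N (Φ N)) Φ ρ u θ 0 →
          ∀ t ∈ Set.Ioo 0 T,
            ∃ A : ℝ, 0 ≤ A ∧ ∀ ε : ℝ, 0 < ε → ∃ w : ℕ → ℝ, (∀ N, 0 < w N) ∧ ∃ N₀ : ℕ, ∀ N : ℕ, N₀ ≤ N →
              (∀ s : ℝ, 0 ≤ s → s + w N ≤ t →
                (klDiv ((Φ N).lawAt (localGibbsLaw σ a₀ u₀ θ₀ N (Φ N)) (s + w N))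
                  (localGibbsLaw σ (fun x => ρ (s + w N) x * Rf (σ ^ 3 * ρ (s + w N) x)) (u (s + w N))
                    (θ (s + w N)) N (Φ N))).toReal ≤
                (1 + A * w N) * (klDiv ((Φ N).lawAt (localGibbsLaw σ a₀ u₀ θ₀ N (Φ N)) s)
                  (localGibbsLaw σ (fun x => ρ s x * Rf (σ ^ 3 * ρ s x)) (u s) (θ s) N (Φ N))).toReal +
                  w N * ((N : ℝ) + 1) * ε) ∧
              (∀ s : ℝ, 0 ≤ s → s ≤ t → t ≤ s + w N →
                (klDiv ((Φ N).lawAt (localGibbsLaw σ a₀ u₀ θ₀ N (Φ N)) t)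
                  (localGibbsLaw σ (fun x => ρ t x * Rf (σ ^ 3 * ρ t x)) (u t) (θ t) N (Φ N))).toReal ≤
                (klDiv ((Φ N).lawAt (localGibbsLaw σ a₀ u₀ θ₀ N (Φ N)) s)
                  (localGibbsLaw σ (fun x => ρ s x * Rf (σ ^ 3 * ρ s x)) (u s) (θ s) N (Φ N))).toReal +
                  ((N : ℝ) + 1) * ε) 

/-! ## §3 Kernel-checked composition: heart (+ landed glue) ⇒ restated clock -/

/-- **The restated heart gives Yau's estimate along the explicit reference family** (`ClampedCurrentsDockReduction.RelEntropyCoreRf`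
with the restated LD/tail inputs prepended): telescoping over grid windows (the heart) + `H_N(0) = 0` (`stub_timeZeroReference`, p101191,
with `klDiv_lawAt_zero_localGibbsLaw`) fed into the abstract window Gronwall (`stub_discreteEntropyGronwall`, p100251), `ℝ≥0∞`
bookkeeping by finiteness. Adapted verbatim from the line's sorry-free glue `gronwallCoreRf_of_stubs`. [cite: Yau1991, §2] -/
theorem relEntropyCoreRf_of_windowStepRestated (step : WindowEntropyStepRestated) (hfin : KlDivLawAtLocalGibbsFinite) :
    KineticWindowLDUniform → KineticWindowLDUniformBounded → LocalClampedTransferWindowLDUniform → TransferActivityTails →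
    EnergyCurrentTails →
    ∀ (r : ℝ) (Rf : ℝ → ℝ), 0 < r →
      (∀ x ∈ Ioo (-r) r, 0 < Rf x ∧ Rf x * (∑' j : ℕ, bE j / (j.factorial : ℝ) * (x * Rf x) ^ j) = 1) →
      (∀ x ∈ Icc 0 r, 1 ≤ Rf x ∧ Rf x ≤ 2) → ContinuousOn Rf (Icc 0 r) →
      (∀ x ∈ Ioo (-r) r, ∀ R ∈ Icc (1 / 2 : ℝ) 2,
        R * (∑' j : ℕ, bE j / (j.factorial : ℝ) * (x * R) ^ j) = 1 → R = Rf x) →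
      ∀ η₀ : ℝ, 0 < η₀ →
      (∀ (a θ₀ : T3 → ℝ) (u₀ : T3 → V3), Continuous a → Continuous θ₀ → Continuous u₀ → (∀ x, 0 < a x) →
        (∀ x, 0 < θ₀ x) → ∀ σ : ℝ, 0 < σ → σ ^ 3 * (⨆ x, a x) ≤ η₀ * ∫ x, a x →
        ∃ ρ₀ : T3 → ℝ, Continuous ρ₀ ∧ (∀ x, 0 < ρ₀ x) ∧
          (∀ (N : ℕ) (Φ : HardSphereFlow (Torus.geometry (Fin 3)) (hsDiameter σ N) (N + 1)),
            IsProbabilityMeasure (localGibbsLaw σ a u₀ θ₀ N Φ)) ∧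
          ∀ χ : T3 → ℝ, Continuous χ → ∀ δ : ℝ, 0 < δ → ∃ C : ℝ, 0 < C ∧
            ∀ (N : ℕ) (Φ : HardSphereFlow (Torus.geometry (Fin 3)) (hsDiameter σ N) (N + 1)),
              localGibbsLaw σ a u₀ θ₀ N Φ {z | δ < |empiricalDensityField z χ - ∫ x, χ x * ρ₀ x|} ≤
                  ENNReal.ofReal (C * Real.exp (-(C⁻¹ * ((N : ℝ) + 1)))) ∧
                localGibbsLaw σ a u₀ θ₀ N Φ
                    {z | δ < ‖empiricalMomentumField z χ - ∫ x, (χ x * ρ₀ x) • u₀ x‖} ≤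
                  ENNReal.ofReal (C * Real.exp (-(C⁻¹ * ((N : ℝ) + 1)))) ∧
                localGibbsLaw σ a u₀ θ₀ N Φ {z | δ < |empiricalEnergyField z χ -
                    ∫ x, χ x * totalEnergyDensity (ρ₀ x) (u₀ x) (θ₀ x)|} ≤
                  ENNReal.ofReal (C * Real.exp (-(C⁻¹ * ((N : ℝ) + 1))))) →
      HsEosLowDensity → DiluteSelfConsistency →
      ∀ (a₀ θ₀ : T3 → ℝ) (u₀ : T3 → V3), Continuous a₀ → Continuous θ₀ → Continuous u₀ →
        (∀ x, 0 < a₀ x) → (∀ x, 0 < θ₀ x) →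
        ∃ σ₀ : ℝ, 0 < σ₀ ∧ ∀ σ : ℝ, 0 < σ → σ < σ₀ →
          ∀ (T : ℝ) (ρ θ : ℝ → T3 → ℝ) (u : ℝ → T3 → V3), IsHardSphereEulerSolution σ T ρ u θ →
            ∀ Φ : (N : ℕ) → HardSphereFlow (Torus.geometry (Fin 3)) (hsDiameter σ N) (N + 1),
              TendstoHydroFieldsAt (fun N => localGibbsLaw σ a₀ u₀ θ₀ N (Φ N)) Φ ρ u θ 0 →
              ∀ t ∈ Set.Ioo 0 T, ∀ (hac : Continuous fun x => ρ t x * Rf (σ ^ 3 * ρ t x))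
                (hap : ∀ x, 0 < ρ t x * Rf (σ ^ 3 * ρ t x)),
                (∀ x, ρ t x ≤ ρ t x * Rf (σ ^ 3 * ρ t x) ∧ ρ t x * Rf (σ ^ 3 * ρ t x) ≤ 2 * ρ t x) →
                SmallDensity (profileOf (fun x => ρ t x * Rf (σ ^ 3 * ρ t x)) hac hap) σ →
                rhoLim (profileOf (fun x => ρ t x * Rf (σ ^ 3 * ρ t x)) hac hap) σ = ρ t →
                Tendsto (fun N : ℕ => klDiv ((Φ N).lawAt (localGibbsLaw σ a₀ u₀ θ₀ N (Φ N)) t)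
                  (localGibbsLaw σ (fun x => ρ t x * Rf (σ ^ 3 * ρ t x)) (u t) (θ t) N (Φ N)) /
                    ((N : ℝ≥0∞) + 1)) atTop (𝓝 0) := by
  intro hK hKb hC hT h₆ r Rf hr hsol hbd hcont huniq η₀ hη₀ HU hEos hS a₀ θ₀ u₀ ha hθ hu ha0 hθ0
  obtain ⟨σb, hσb, Hb⟩ := step hr hsol hbd hcont huniq hη₀ HU hK hKb hC hT h₆ hEos hS
    a₀ θ₀ u₀ ha hθ hu ha0 hθ0
  obtain ⟨σc, hσc, Hc⟩ := stub_timeZeroReference hr hsol hbd hcont huniq a₀ θ₀ u₀ ha hθ hu ha0 hθ0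
  -- dilute self-consistency at `η = r/2` keeps `σ³ρ_s` inside the domain of `Rf`
  obtain ⟨σd, hσd, Hd⟩ := hS (r / 2) (by positivity) a₀ θ₀ u₀ ha hθ hu ha0 hθ0
  refine ⟨min σb (min σc (min σd (1 / 2))), lt_min hσb (lt_min hσc (lt_min hσd (by norm_num))), ?_⟩
  intro σ hσ hσlt T ρ θ u hE Φ htie t ht _hac _hap _hale _hQs _hlim
  have hσb' : σ < σb := hσlt.trans_le (min_le_left _ _)
  have hσc' : σ < σc := hσlt.trans_le ((min_le_right _ _).trans (min_le_left _ _))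
  have hσd' : σ < σd := hσlt.trans_le ((min_le_right _ _).trans ((min_le_right _ _).trans (min_le_left _ _)))
  have hσ2 : σ ≤ 1 / 2 :=
    (hσlt.trans_le ((min_le_right _ _).trans ((min_le_right _ _).trans (min_le_right _ _)))).le
  have hT : 0 < T := ht.1.trans ht.2
  obtain ⟨A, hA, hstep⟩ := Hb σ hσ hσb' T ρ θ u hE Φ htie t ht
  have hlaw := Hc σ hσ hσc' T ρ θ u hE hT Φ htie
  -- finiteness of the relative entropies along the explicit reference family on `[0, t]` (S7b-i)
  have hfin : ∀ (N : ℕ) (s : ℝ), s ∈ Set.Icc 0 t →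
      klDiv ((Φ N).lawAt (localGibbsLaw σ a₀ u₀ θ₀ N (Φ N)) s)
        (localGibbsLaw σ (fun x => ρ s x * Rf (σ ^ 3 * ρ s x)) (u s) (θ s) N (Φ N)) ≠ ⊤ := by
    intro N s hs
    have hsI : s ∈ Ico 0 T := ⟨hs.1, hs.2.trans_lt ht.2⟩
    have hρc : Continuous (ρ s) := (hE.smooth_density.isSmooth_slice hsI).continuous
    have huc : Continuous (u s) := (hE.smooth_velocity.isSmooth_slice hsI).continuous
    have hθc : Continuous (θ s) := (hE.smooth_temperature.isSmooth_slice hsI).continuous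
    have hρpos : ∀ x, 0 < ρ s x := hE.density_pos s hsI
    have hθpos : ∀ x, 0 < θ s x := hE.temperature_pos s hsI
    have hσ3 : 0 < σ ^ 3 := by positivity
    have hmem : ∀ x, σ ^ 3 * ρ s x ∈ Icc 0 r := fun x => by
      have h := Hd σ hσ hσd' T ρ θ u hE Φ htie s hsI x
      exact ⟨(mul_pos hσ3 (hρpos x)).le, by nlinarith [h, hρpos x, hr]⟩
    have hbc : Continuous fun x => ρ s x * Rf (σ ^ 3 * ρ s x) :=
      hρc.mul (hcont.comp_continuous (continuous_const.mul hρc) hmem)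
    have hbpos : ∀ x, 0 < ρ s x * Rf (σ ^ 3 * ρ s x) := fun x =>
      mul_pos (hρpos x) (one_pos.trans_le (hbd _ (hmem x)).1)
    exact hfin hσ hσ2 ha hθ hu ha0 hθ0 hbc hθc huc hbpos hθpos N (Φ N) s
  -- the real-valued entropies along the explicit reference family
  set H : ℕ → ℝ → ℝ := fun N s =>
    (klDiv ((Φ N).lawAt (localGibbsLaw σ a₀ u₀ θ₀ N (Φ N)) s)
      (localGibbsLaw σ (fun x => ρ s x * Rf (σ ^ 3 * ρ s x)) (u s) (θ s) N (Φ N))).toReal with hH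
  have hH0 : ∀ N s, 0 ≤ H N s := fun N s => ENNReal.toReal_nonneg
  have hzero : Tendsto (fun N : ℕ => H N 0 / ((N : ℝ) + 1)) atTop (𝓝 0) := by
    have h0 : ∀ N, H N 0 = 0 := by
      intro N
      simp only [hH, hlaw N, klDiv_lawAt_zero_localGibbsLaw hσ2 ha hθ hu ha0 hθ0 N (Φ N),
        ENNReal.toReal_zero]
    simp only [h0, zero_div]
    exact tendsto_const_nhds
  have hreal : Tendsto (fun N : ℕ => H N t / ((N : ℝ) + 1)) atTop (𝓝 0) :=
    stub_discreteEntropyGronwall H ht.1 hA hH0 hzero hstep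
  -- back to `ℝ≥0∞`
  have hcongr : ∀ N : ℕ, klDiv ((Φ N).lawAt (localGibbsLaw σ a₀ u₀ θ₀ N (Φ N)) t)
      (localGibbsLaw σ (fun x => ρ t x * Rf (σ ^ 3 * ρ t x)) (u t) (θ t) N (Φ N)) / ((N : ℝ≥0∞) + 1) =
      ENNReal.ofReal (H N t / ((N : ℝ) + 1)) := by
    intro N
    have hNpos : (0 : ℝ) < (N : ℝ) + 1 := by positivity
    rw [ENNReal.ofReal_div_of_pos hNpos, hH, ENNReal.ofReal_toReal (hfin N t ⟨ht.1.le, le_rfl⟩)]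
    congr 1
    rw [ENNReal.ofReal_add (by positivity) zero_le_one, ENNReal.ofReal_natCast, ENNReal.ofReal_one]
  simp only [hcongr]
  rw [← ENNReal.ofReal_zero]
  exact ENNReal.tendsto_ofReal hreal


/-- **KERNEL-CHECKED RESIDUE OF THE RESTATED CLOCK.** `ClampedEntropyClockRestated` follows from the restated one-window step (the ONE
open XL obligation) and the finiteness lemma (landed, p107857), through the landed glue of both docks: this file's
`relEntropyCoreRf_of_windowStepRestated` and the antecedent-agnostic reduction
`ClampedCurrentsDockReduction.stub_reduction : RelEntropyCoreRf → DiluteSelfConsistency → HydrodynamicLimit` (14680 S1, p97835; the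
two routes' `DiluteSelfConsistency` agree definitionally). [cite: Yau1991, §2] -/
theorem clampedEntropyClockRestated_of (step : WindowEntropyStepRestated) (hfin : KlDivLawAtLocalGibbsFinite) :
    ClampedEntropyClockRestated := by
  intro hK hKb hC hT h₆ hS
  refine ClampedCurrentsDockReduction.stub_reduction ?_ hS
  intro r Rf hr hsol hbd hcont huniq η₀ hη₀ HU hEos hS'
  exact relEntropyCoreRf_of_windowStepRestated step hfin hK hKb hC hT h₆ r Rf hr hsol hbd hcont huniq η₀ hη₀ HU hEos hS'

end Summit.AtomisticToContinuum.HydrodynamicLimit.Theorems.QuenchedCellClock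

end
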